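import Literature.NumberTheory.ModularForms.KernelResidues
import Literature.NumberTheory.ModularForms.KernelBounds8
import Literature.NumberTheory.ModularForms.KernelBounds24Minus
import HarnessLib

/-!
# The kernels `𝒦^{(8)}, 𝒦^{(24)}` of CKMRV Theorem 4.1: functional equations, residues, decay

Cohn–Kumar–Miller–Radchenko–Viazovska, arXiv:1902.05438, Theorem 4.1 and (4.12):
`𝒦± = 𝒦|_{d/2}(I ∓ S)`, so `𝒦 = (𝒦₊ + 𝒦₋)/2` and `−𝒦|S = (𝒦₊ − 𝒦₋)/2 = 𝒦̂`; Theorem 4.1 (2):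
`𝒦|(T − I)² = 0`, `𝒦|S(T − I)² = 0`; (3): `Res_{τ=z}(𝒦|r) = −φ(r)/2π` with
`φ(I) = 0, φ(T) = 1, φ(TS) = 0, φ(S) = 0, φ(ST) = 0, φ(STS) = 0`; (4)/(4.14): for fixed `z`,
`𝒦^{(8)} = O(|τe^{2πiτ}|)`, `𝒦^{(24)} = O(|τe^{4πiτ}|)`.

Everything below is proved, assembling the explicit kernels `kernelPlus8, …` of
`InterpolationKernels.lean`: definitions `kernel8 = (𝒦₊^{(8)} + 𝒦₋^{(8)})/2`, `kernel24`;
`HasKernelResidue` is linear (`.add`, `.const_smul`); **Theorem 4.1 (2) for `𝒦`**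
(`kernel8_functionalEquations`, `kernel24_functionalEquations`, with `𝒦|S = (𝒦₋ − 𝒦₊)/2`);
**Theorem 4.1 (3) for `𝒦` at non-elliptic `z`** for the six words `I, T, TS, S, ST, STS`
(`kernel8_residues`, `kernel24_residues`; residues `0, −1/2π, 0, 0, 0, 0`); **Theorem 4.1 (4),
(4.14) for `𝒦`** (`kernel8_isBigO`, `kernel24_isBigO`).
Not treated: elliptic `z` in (3), the simplicity statement (1) beyond what the residues give, and
uniqueness.

## References

* H. Cohn, A. Kumar, S. D. Miller, D. Radchenko, M. Viazovska, Ann. of Math. 196 (2022),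
  arXiv:1902.05438, Theorem 4.1, (4.12), (4.14). [CohnEtAl2019]
-/

noncomputable section

open Complex hiding I
open Filter Topology Asymptotics ModularForm SlashInvariantForm EisensteinSeries
open UpperHalfPlane hiding I
open Complex (I)
open scoped Real MatrixGroups ModularForm Manifold

namespace Literature.NumberTheory.ModularForms

open Literature.NumberTheory.EllipticCurves.ModularForms (kleinJ)

/-! ## The kernels `𝒦 = (𝒦₊ + 𝒦₋)/2` -/

/-- **`𝒦^{(8)} = (𝒦₊^{(8)} + 𝒦₋^{(8)})/2`** (from `𝒦± = 𝒦|(I ∓ S)`, (4.12)). [cite: CohnEtAl2019, §4 (4.12)] -/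
def kernel8 (τ z : ℍ) : ℂ := (kernelPlus8 τ z + kernelMinus8 τ z) / 2

/-- **`𝒦^{(24)} = (𝒦₊^{(24)} + 𝒦₋^{(24)})/2`.** [cite: CohnEtAl2019, §4 (4.12)] -/
def kernel24 (τ z : ℍ) : ℂ := (kernelPlus24 τ z + kernelMinus24 τ z) / 2

/-- `kernel8_eq` (auxiliary). [folklore] -/
theorem kernel8_eq (z : ℍ) : (fun τ => kernel8 τ z) = (2 : ℂ)⁻¹ • ((fun τ => kernelPlus8 τ z) + fun τ => kernelMinus8 τ z) := by
  funext τ; simp [kernel8, div_eq_inv_mul]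

/-- `kernel24_eq` (auxiliary). [folklore] -/
theorem kernel24_eq (z : ℍ) : (fun τ => kernel24 τ z) = (2 : ℂ)⁻¹ • ((fun τ => kernelPlus24 τ z) + fun τ => kernelMinus24 τ z) := by
  funext τ; simp [kernel24, div_eq_inv_mul]

/-! ## Theorem 4.1 (2) for `𝒦` -/

/-- From `𝒦₊|(T−I)² = 0 = 𝒦₋|(T−I)²`, `𝒦₊|S = −𝒦₊`, `𝒦₋|S = 𝒦₋`: the sum `g = a𝒦₊ + b𝒦₋` satisfies
`g|(T−I)² = 0`. [cite: CohnEtAl2019, Theorem 4.1 (2)] -/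
theorem T_sq_of_ann {k : ℤ} {P M : ℍ → ℂ} (hP : IsAnnPlus k P) (hM : IsAnnMinus k M) (a b : ℂ) :
    ((a • P + b • M) ∣[k] ModularGroup.T) ∣[k] ModularGroup.T - (2 : ℂ) • (a • P + b • M) ∣[k] ModularGroup.T
      + (a • P + b • M) = 0 := by
  have h1 := congrArg (a • ·) hP.T_sq
  have h2 := congrArg (b • ·) hM.T_sq
  simp only [smul_zero, smul_sub, smul_add] at h1 h2
  simp only [SlashAction.add_slash, SL_smul_slash, smul_add]
  rw [smul_comm (2 : ℂ) a, smul_comm (2 : ℂ) b]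
  linear_combination (exp := 1) h1 + h2

/-- **Theorem 4.1 (2) for `𝒦^{(8)}`**: `𝒦|₄(T − I)² = 0` and `𝒦|₄S(T − I)² = 0`, together with
`𝒦|₄S = (𝒦₋ − 𝒦₊)/2`. [cite: CohnEtAl2019, Theorem 4.1 (2)] -/
theorem kernel8_functionalEquations (z : ℍ) :
    (((fun τ => kernel8 τ z) ∣[(4 : ℤ)] ModularGroup.T) ∣[(4 : ℤ)] ModularGroup.T
        - (2 : ℂ) • (fun τ => kernel8 τ z) ∣[(4 : ℤ)] ModularGroup.T + (fun τ => kernel8 τ z) = 0) ∧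
    ((fun τ => kernel8 τ z) ∣[(4 : ℤ)] ModularGroup.S =
        (2 : ℂ)⁻¹ • ((fun τ => kernelMinus8 τ z) - fun τ => kernelPlus8 τ z)) ∧
    ((((fun τ => kernel8 τ z) ∣[(4 : ℤ)] ModularGroup.S) ∣[(4 : ℤ)] ModularGroup.T) ∣[(4 : ℤ)] ModularGroup.T
        - (2 : ℂ) • ((fun τ => kernel8 τ z) ∣[(4 : ℤ)] ModularGroup.S) ∣[(4 : ℤ)] ModularGroup.T
        + (fun τ => kernel8 τ z) ∣[(4 : ℤ)] ModularGroup.S = 0) := by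
  have hP := isAnnPlus_kernelPlus8 z
  have hM := isAnnMinus_kernelMinus8 z
  have hS : (fun τ => kernel8 τ z) ∣[(4 : ℤ)] ModularGroup.S =
      (2 : ℂ)⁻¹ • ((fun τ => kernelMinus8 τ z) - fun τ => kernelPlus8 τ z) := by
    have h1 : (fun τ => kernelPlus8 τ z) ∣[(4 : ℤ)] ModularGroup.S = -(fun τ => kernelPlus8 τ z) :=
      eq_neg_of_add_eq_zero_left hP.S_add
    have h2 : (fun τ => kernelMinus8 τ z) ∣[(4 : ℤ)] ModularGroup.S = (fun τ => kernelMinus8 τ z) := hM.S_sub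
    rw [kernel8_eq, SL_smul_slash, SlashAction.add_slash, h1, h2]
    congr 1; abel
  refine ⟨?_, hS, ?_⟩
  · have := T_sq_of_ann hP hM (2 : ℂ)⁻¹ (2 : ℂ)⁻¹
    rw [kernel8_eq, smul_add]
    exact this
  · have := T_sq_of_ann hP hM (-(2 : ℂ)⁻¹) (2 : ℂ)⁻¹
    rw [hS, show (2 : ℂ)⁻¹ • ((fun τ => kernelMinus8 τ z) - fun τ => kernelPlus8 τ z) =
      (-(2 : ℂ)⁻¹) • (fun τ => kernelPlus8 τ z) + (2 : ℂ)⁻¹ • (fun τ => kernelMinus8 τ z) by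
        funext τ; simp only [Pi.add_apply, Pi.sub_apply, Pi.smul_apply, smul_eq_mul]; ring]
    exact this

/-- **Theorem 4.1 (2) for `𝒦^{(24)}`** (weight `12`). [cite: CohnEtAl2019, Theorem 4.1 (2)] -/
theorem kernel24_functionalEquations (z : ℍ) :
    (((fun τ => kernel24 τ z) ∣[(12 : ℤ)] ModularGroup.T) ∣[(12 : ℤ)] ModularGroup.T
        - (2 : ℂ) • (fun τ => kernel24 τ z) ∣[(12 : ℤ)] ModularGroup.T + (fun τ => kernel24 τ z) = 0) ∧
    ((fun τ => kernel24 τ z) ∣[(12 : ℤ)] ModularGroup.S =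
        (2 : ℂ)⁻¹ • ((fun τ => kernelMinus24 τ z) - fun τ => kernelPlus24 τ z)) ∧
    ((((fun τ => kernel24 τ z) ∣[(12 : ℤ)] ModularGroup.S) ∣[(12 : ℤ)] ModularGroup.T) ∣[(12 : ℤ)] ModularGroup.T
        - (2 : ℂ) • ((fun τ => kernel24 τ z) ∣[(12 : ℤ)] ModularGroup.S) ∣[(12 : ℤ)] ModularGroup.T
        + (fun τ => kernel24 τ z) ∣[(12 : ℤ)] ModularGroup.S = 0) := by
  have hP := isAnnPlus_kernelPlus24 z
  have hM := isAnnMinus_kernelMinus24 z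
  have hS : (fun τ => kernel24 τ z) ∣[(12 : ℤ)] ModularGroup.S =
      (2 : ℂ)⁻¹ • ((fun τ => kernelMinus24 τ z) - fun τ => kernelPlus24 τ z) := by
    have h1 : (fun τ => kernelPlus24 τ z) ∣[(12 : ℤ)] ModularGroup.S = -(fun τ => kernelPlus24 τ z) :=
      eq_neg_of_add_eq_zero_left hP.S_add
    have h2 : (fun τ => kernelMinus24 τ z) ∣[(12 : ℤ)] ModularGroup.S = (fun τ => kernelMinus24 τ z) := hM.S_sub
    rw [kernel24_eq, SL_smul_slash, SlashAction.add_slash, h1, h2]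
    congr 1; abel
  refine ⟨?_, hS, ?_⟩
  · have := T_sq_of_ann hP hM (2 : ℂ)⁻¹ (2 : ℂ)⁻¹
    rw [kernel24_eq, smul_add]
    exact this
  · have := T_sq_of_ann hP hM (-(2 : ℂ)⁻¹) (2 : ℂ)⁻¹
    rw [hS, show (2 : ℂ)⁻¹ • ((fun τ => kernelMinus24 τ z) - fun τ => kernelPlus24 τ z) =
      (-(2 : ℂ)⁻¹) • (fun τ => kernelPlus24 τ z) + (2 : ℂ)⁻¹ • (fun τ => kernelMinus24 τ z) by
        funext τ; simp only [Pi.add_apply, Pi.sub_apply, Pi.smul_apply, smul_eq_mul]; ring]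
    exact this

/-! ## Linearity of residues -/

/-- `HasKernelResidue.add` (auxiliary). [folklore] -/
theorem HasKernelResidue.add {g₁ g₂ : ℍ → ℂ} {z : ℍ} {r₁ r₂ : ℂ} (h₁ : HasKernelResidue g₁ z r₁)
    (h₂ : HasKernelResidue g₂ z r₂) : HasKernelResidue (g₁ + g₂) z (r₁ + r₂) := by
  unfold HasKernelResidue at *
  have := h₁.add h₂
  refine this.congr fun w => ?_
  simp only [Pi.add_apply]; ring

/-- `HasKernelResidue.const_smul` (auxiliary). [folklore] -/
theorem HasKernelResidue.const_smul {g : ℍ → ℂ} {z : ℍ} {r : ℂ} (h : HasKernelResidue g z r) (c : ℂ) :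
    HasKernelResidue (c • g) z (c * r) := by
  unfold HasKernelResidue at *
  have := h.const_mul c
  refine this.congr fun w => ?_
  simp only [Pi.smul_apply, smul_eq_mul]; ring

/-- Residues of `a•P + b•M` slashed by `γ`. [folklore] -/
theorem hasKernelResidue_lincomb_slash {k : ℤ} {P M : ℍ → ℂ} {z : ℍ} {rP rM : ℂ} (γ : SL(2, ℤ)) (a b : ℂ)
    (hP : HasKernelResidue (P ∣[k] γ) z rP) (hM : HasKernelResidue (M ∣[k] γ) z rM) :
    HasKernelResidue ((a • P + b • M) ∣[k] γ) z (a * rP + b * rM) := by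
  have := (hP.const_smul a).add (hM.const_smul b)
  rwa [SlashAction.add_slash, SL_smul_slash, SL_smul_slash]

/-! ## Theorem 4.1 (3) for `𝒦` (non-elliptic `z`) -/

/-- **Theorem 4.1 (3) for `𝒦^{(8)}`** at `z` with `j′(z) ≠ 0`: the residues at `τ = z` of
`𝒦, 𝒦|T, 𝒦|TS, 𝒦|S, 𝒦|ST, 𝒦|STS` are `0, −1/(2π), 0, 0, 0, 0` (`= −φ(r)/2π`).
[cite: CohnEtAl2019, Theorem 4.1 (3)] -/
theorem kernel8_residues (z : ℍ) (hj : deriv (kleinJ ∘ ofComplex) z ≠ 0) :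
    HasKernelResidue (fun τ => kernel8 τ z) z 0 ∧
    HasKernelResidue ((fun τ => kernel8 τ z) ∣[(4 : ℤ)] ModularGroup.T) z (-1 / (2 * π)) ∧
    HasKernelResidue ((fun τ => kernel8 τ z) ∣[(4 : ℤ)] (ModularGroup.T * ModularGroup.S)) z 0 ∧
    HasKernelResidue ((fun τ => kernel8 τ z) ∣[(4 : ℤ)] ModularGroup.S) z 0 ∧
    HasKernelResidue ((fun τ => kernel8 τ z) ∣[(4 : ℤ)] (ModularGroup.S * ModularGroup.T)) z 0 ∧
    HasKernelResidue ((fun τ => kernel8 τ z) ∣[(4 : ℤ)] (ModularGroup.S * ModularGroup.T * ModularGroup.S)) z 0 := by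
  set P : ℍ → ℂ := fun τ => kernelPlus8 τ z with hPdef
  set M : ℍ → ℂ := fun τ => kernelMinus8 τ z with hMdef
  have hK : (fun τ => kernel8 τ z) = (2 : ℂ)⁻¹ • P + (2 : ℂ)⁻¹ • M := by rw [kernel8_eq, smul_add]
  obtain ⟨_, hS, _⟩ := kernel8_functionalEquations z
  have hKS : (fun τ => kernel8 τ z) ∣[(4 : ℤ)] ModularGroup.S = (-(2 : ℂ)⁻¹) • P + (2 : ℂ)⁻¹ • M := by
    rw [hS]; funext τ; simp only [Pi.add_apply, Pi.sub_apply, Pi.smul_apply, smul_eq_mul]; ring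
  have p0 := hasKernelResidue_kernelPlus8 z hj
  have pT := hasKernelResidue_kernelPlus8_slash_T z hj
  have pTS := hasKernelResidue_kernelPlus8_slash_TS z hj
  have m0 := hasKernelResidue_kernelMinus8 z hj
  have mT := hasKernelResidue_kernelMinus8_slash_T z hj
  have mTS := hasKernelResidue_kernelMinus8_slash_TS z hj
  have p0' : HasKernelResidue (P ∣[(4 : ℤ)] (1 : SL(2, ℤ))) z 0 := by rw [SlashAction.slash_one]; exact p0
  have m0' : HasKernelResidue (M ∣[(4 : ℤ)] (1 : SL(2, ℤ))) z 0 := by rw [SlashAction.slash_one]; exact m0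
  refine ⟨?_, ?_, ?_, ?_, ?_, ?_⟩
  · have := hasKernelResidue_lincomb_slash 1 (2 : ℂ)⁻¹ (2 : ℂ)⁻¹ p0' m0'
    rw [SlashAction.slash_one, ← hK] at this
    simpa using this
  · have := hasKernelResidue_lincomb_slash ModularGroup.T (2 : ℂ)⁻¹ (2 : ℂ)⁻¹ pT mT
    rw [← hK] at this
    convert this using 1; ring
  · have := hasKernelResidue_lincomb_slash (ModularGroup.T * ModularGroup.S) (2 : ℂ)⁻¹ (2 : ℂ)⁻¹ pTS mTS
    rw [← hK] at this
    simpa using this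
  · have := hasKernelResidue_lincomb_slash 1 (-(2 : ℂ)⁻¹) (2 : ℂ)⁻¹ p0' m0'
    rw [SlashAction.slash_one, ← hKS] at this
    simpa using this
  · have := hasKernelResidue_lincomb_slash ModularGroup.T (-(2 : ℂ)⁻¹) (2 : ℂ)⁻¹ pT mT
    rw [← hKS, ← SlashAction.slash_mul] at this
    convert this using 1; ring
  · have := hasKernelResidue_lincomb_slash (ModularGroup.T * ModularGroup.S) (-(2 : ℂ)⁻¹) (2 : ℂ)⁻¹ pTS mTS
    rw [← hKS, ← SlashAction.slash_mul, ← mul_assoc] at this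
    simpa using this

/-- **Theorem 4.1 (3) for `𝒦^{(24)}`** at `z` with `j′(z) ≠ 0` (weight `12`): residues
`0, −1/(2π), 0, 0, 0, 0` for `I, T, TS, S, ST, STS`. [cite: CohnEtAl2019, Theorem 4.1 (3)] -/
theorem kernel24_residues (z : ℍ) (hj : deriv (kleinJ ∘ ofComplex) z ≠ 0) :
    HasKernelResidue (fun τ => kernel24 τ z) z 0 ∧
    HasKernelResidue ((fun τ => kernel24 τ z) ∣[(12 : ℤ)] ModularGroup.T) z (-1 / (2 * π)) ∧
    HasKernelResidue ((fun τ => kernel24 τ z) ∣[(12 : ℤ)] (ModularGroup.T * ModularGroup.S)) z 0 ∧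
    HasKernelResidue ((fun τ => kernel24 τ z) ∣[(12 : ℤ)] ModularGroup.S) z 0 ∧
    HasKernelResidue ((fun τ => kernel24 τ z) ∣[(12 : ℤ)] (ModularGroup.S * ModularGroup.T)) z 0 ∧
    HasKernelResidue ((fun τ => kernel24 τ z) ∣[(12 : ℤ)] (ModularGroup.S * ModularGroup.T * ModularGroup.S)) z 0 := by
  set P : ℍ → ℂ := fun τ => kernelPlus24 τ z with hPdef
  set M : ℍ → ℂ := fun τ => kernelMinus24 τ z with hMdef
  have hK : (fun τ => kernel24 τ z) = (2 : ℂ)⁻¹ • P + (2 : ℂ)⁻¹ • M := by rw [kernel24_eq, smul_add]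
  obtain ⟨_, hS, _⟩ := kernel24_functionalEquations z
  have hKS : (fun τ => kernel24 τ z) ∣[(12 : ℤ)] ModularGroup.S = (-(2 : ℂ)⁻¹) • P + (2 : ℂ)⁻¹ • M := by
    rw [hS]; funext τ; simp only [Pi.add_apply, Pi.sub_apply, Pi.smul_apply, smul_eq_mul]; ring
  obtain ⟨p0, pT, pTS⟩ := hasKernelResidue_kernelPlus24 z hj
  obtain ⟨m0, mT, mTS⟩ := hasKernelResidue_kernelMinus24 z hj
  have p0' : HasKernelResidue (P ∣[(12 : ℤ)] (1 : SL(2, ℤ))) z 0 := by rw [SlashAction.slash_one]; exact p0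
  have m0' : HasKernelResidue (M ∣[(12 : ℤ)] (1 : SL(2, ℤ))) z 0 := by rw [SlashAction.slash_one]; exact m0
  refine ⟨?_, ?_, ?_, ?_, ?_, ?_⟩
  · have := hasKernelResidue_lincomb_slash 1 (2 : ℂ)⁻¹ (2 : ℂ)⁻¹ p0' m0'
    rw [SlashAction.slash_one, ← hK] at this
    simpa using this
  · have := hasKernelResidue_lincomb_slash ModularGroup.T (2 : ℂ)⁻¹ (2 : ℂ)⁻¹ pT mT
    rw [← hK] at this
    convert this using 1; ring
  · have := hasKernelResidue_lincomb_slash (ModularGroup.T * ModularGroup.S) (2 : ℂ)⁻¹ (2 : ℂ)⁻¹ pTS mTS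
    rw [← hK] at this
    simpa using this
  · have := hasKernelResidue_lincomb_slash 1 (-(2 : ℂ)⁻¹) (2 : ℂ)⁻¹ p0' m0'
    rw [SlashAction.slash_one, ← hKS] at this
    simpa using this
  · have := hasKernelResidue_lincomb_slash ModularGroup.T (-(2 : ℂ)⁻¹) (2 : ℂ)⁻¹ pT mT
    rw [← hKS, ← SlashAction.slash_mul] at this
    convert this using 1; ring
  · have := hasKernelResidue_lincomb_slash (ModularGroup.T * ModularGroup.S) (-(2 : ℂ)⁻¹) (2 : ℂ)⁻¹ pTS mTS
    rw [← hKS, ← SlashAction.slash_mul, ← mul_assoc] at this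
    simpa using this

/-! ## Theorem 4.1 (4): decay (4.14) for `𝒦` -/

/-- **(4.14) for `𝒦^{(8)}`**: `𝒦^{(8)}(τ, z) = O(|τ| e^{−2π Im τ})` for fixed `z`. [cite: CohnEtAl2019, §4.4 (4.14)] -/
theorem kernel8_isBigO (z : ℍ) :
    (fun τ => kernel8 τ z) =O[atImInfty] fun τ : ℍ => ‖(τ : ℂ)‖ * expDecay τ := by
  have := ((kernelPlus8_isBigO z).add (kernelMinus8_isBigO z)).const_mul_left (2 : ℂ)⁻¹
  exact this.congr_left fun τ => by simp [kernel8, div_eq_inv_mul]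

/-- **(4.14) for `𝒦^{(24)}`**: `𝒦^{(24)}(τ, z) = O(|τ| e^{−4π Im τ})` for fixed `z`. [cite: CohnEtAl2019, §4.4 (4.14)] -/
theorem kernel24_isBigO (z : ℍ) :
    (fun τ => kernel24 τ z) =O[atImInfty] fun τ : ℍ => ‖(τ : ℂ)‖ * expDecay τ ^ 2 := by
  have := ((kernelPlus24_isBigO z).add (kernelMinus24_isBigO z)).const_mul_left (2 : ℂ)⁻¹
  exact this.congr_left fun τ => by simp [kernel24, div_eq_inv_mul]

end Literature.NumberTheory.ModularForms
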